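import Summits.ResolutionOfSingularities.ResolutionOfSingularities.Theorems.HilbertSamuelEliminationSigmaMaxModificationsCorridor3WLadderIsoInsepTailCutDefs
import Summits.ResolutionOfSingularities.ResolutionOfSingularities.Theorems.HilbertSamuelEliminationSigmaMaxModificationsCorridor3WLadderIsoInsepSplitMilnorJacobianRow
import Summits.ResolutionOfSingularities.ResolutionOfSingularities.Theorems.HilbertSamuelEliminationSigmaMaxModificationsCorridor3WLadderIsoInsepSplitMilnorPresentation
import Literature.AlgebraicGeometry.CossartJannsenSaito2020.KeyTheoremsIsolated
import HarnessLib

/-!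
# [OURS · L1 W4.2] k2 PART 3b — the `√λ`-SLICE of honest-split E2 tails onto CJS Key Theorem 6.40 in dimension two (dictionary row + PROVED
# reductions) and the ISOLATION TRANSFER rows `SliceIsoTransfer₂` / `SliceIsoTransferJ₂` with the image ideal `sliceJacobianIdeal`
# (crux chain w42, cell k2 `T3insep` at `p = 2`; typer pass of res-L1-w42-idea-1 Sketch C10 r9.4 §4–§5; `--supports stmt-…-19249`)

OURS (cell res-hironaka, slot W4.2, seat res-D-pv-042); NOT a statement of [Hironaka2017] nor of [CossartJannsenSaito2020] / [Matsumura1987].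
AI-drafted, weaker than expert review. TYPER PASS: statements copied VERBATIM from res-L1-w42-idea-1's
`L/res-L1-w42-idea-1/g9/Sketch-L1-idea-1-C10.lean` sha16 fa8aafac720286e8 §4–§5 (r9.3 precision «K = κ(s) exactly»; tri-2 TRIAGE v10.6/v10.8
SURVIVES; tri-1 v6.5 §R13-H SURVIVES), re-homed into ns `IdeasL1C6` next to PART 3a (`…IsoInsepTailCutDefs`: `IsE2Stage`, `IsHonestSplitInsepAt`,
the tail rows) and PART 2′; uses BY NAME the tree's `KeySetting`, `CharHypothesis`, `IsChainOfFundamentalUnits`, `unitStart`,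
`KeyTheorem640_char_isolated` (Literature CJS `KeyTheoremsIsolated`), `splitEq`, `MilnorAlg` (k2 PART 1/2′) and
`MvPowerSeries.coeffDerivation` (Literature `NagataJacobianCriterion`, p532117), `coeffDerivation_eq_smul_lamPart` (p534482).  Every
`def … : Prop` row is an OURS ROW; every `theorem` is pure logic / one-line algebra over the rows.

* §4 `SurfaceSliceChain₂` (THE `√λ`-SLICE DICTIONARY ROW) and PROVED `isoInsepSplitE2TailImpossible₂_of_slice` (`… → KeyTheorem640_char_isolated →
  IsoInsepSplitE2TailImpossible₂`), `isoInsepE2TailImpossible₂_of_slice`, `isoInsepTowerTerminates₂_of_rows` (k2 at `p = 2` modulo named rows,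
  round-9 form: E0, E1, k2c, NO-JUMP, propagation ×2, slice dictionary, CJS 6.40 (dim 2, printed), LAYERED E2 tails).
* §5 `SliceNoDoubleCurve` ((h,G)-form, `K = κ(s)` exactly), row `SliceIsoTransfer₂`, sanity `not_sliceNoDoubleCurve_of_sq`; the IMAGE-IDEAL form
  of record (tri-2 TRIAGE v10.4 (B)): `sliceJacobianIdeal`, `SliceJacobianPrimary`, row `SliceIsoTransferJ₂`; PROVED `sliceJacobianIdeal_eq_of_hpb`,
  `sliceJacobianPrimary_iff_finite_milnorAlg` (2-rank one: the image-ideal row is EXACTLY S-fin₂'s conclusion `Module.Finite κ (MilnorAlg g)`,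
  cf. `splitMilnorFinite₂_of_nagata`, p535430).

References (pointers only): [CossartJannsenSaito2020, Def. 6.38, Def. 6.39, Thm. 6.40, Lemma 2.37 (2), p. 107]; [Matsumura1987, Thm. 30.10].
-/

noncomputable section

set_option linter.dupNamespace false

open scoped Classical
open CategoryTheory AlgebraicGeometry TopologicalSpace IsLocalRing MvPowerSeries
open Summit.ResolutionOfSingularities.ResolutionOfSingularities.Theorems.CampaignW42
open Literature.AlgebraicGeometry.Resolution Literature.AlgebraicGeometry.CossartJannsenSaito2020
open Summit.ResolutionOfSingularities.ResolutionOfSingularities.Cruxes.SigmaMaxModifications.IdeasL1Idea2R4 (IsIsoPointTower)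
open Summit.ResolutionOfSingularities.ResolutionOfSingularities.Cruxes.SigmaMaxModifications.IdeasL1C5
  (IsInsepStage IsRationalStep IsSatelliteStep IsoFreeRationalTailsImpossible IsoSatelliteRecurrentImpossible IsoInsepTowerTerminates)

namespace Summit.ResolutionOfSingularities.ResolutionOfSingularities.Cruxes.SigmaMaxModifications.IdeasL1C6

/-! ## §4. The `√λ`-SLICE: honest-split E2 tails are chains of fundamental units on an excellent SURFACE (CJS Key Theorem 6.40, printed form) -/

section Slice

universe u

/-- [OURS · L1 W4.2 · C10 · **THE `√λ`-SLICE DICTIONARY ROW**] an isolated E3 point tower over a maximal origin of characteristic two that is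
E2 and honest-split from stage `n₀` on yields an infinite CHAIN OF FUNDAMENTAL UNITS OF LENGTH ONE (CJS Def. 6.38 with `m = 1`, Def. 6.39;
tree `IsChainOfFundamentalUnits … (fun _ ↦ 1)`) on a tower starting at the excellent two-dimensional scheme
`𝒮 = Spec κ_{n₀}(s)⟦X,z,w⟧/(X² + g_{n₀}(z,w))`, `s² = λ` (`KeySetting 𝒮 2`; residue characteristic `2`, so CJS's (F1)
`char ≥ dim/2 + 1` HOLDS: `CharHypothesis`), all of whose points `σ_i` are isolated in the Hilbert–Samuel locus.  Steps (card §M.3):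
(1) base change `κ ↦ κ(s)` of the tail is legal (frozen class: `κ_n ⊗ κ(s) = κ_n(s)` a field, centres stay reduced points; blow-up
commutes with flat base change; Hilbert–Samuel functions and `ē` are unchanged at such points); (2) `sq_add_mul_sq_eq_sq`: the
completed stage is the cylinder `𝒮_n ×̂ 𝔸¹_y`; (3) `x_n` isolated in `X_n(ν)` ⟹ `σ_n` isolated in `𝒮_{n,max} = Sing 𝒮_n`: by Nagata's
Jacobian criterion `Sing X̂_n ↠ Λ⁰_n = V(g_z, g_w, D_c g (c ≠ λ)) ⊆ Spec κ_n⟦z,w⟧` (the `x, y`-coordinates are forced: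
`y² = D_λ g`, `x² = g + λ D_λ g`) while `Sing 𝒮_n ≅ Λ_n = V(g, g_z, g_w, D_c g (c ≠ λ)) ⊆ Λ⁰_n` (`D_λ` does NOT extend to `κ_n(s)`; the new
derivation `D_s` kills `κ_n ⊆ κ_n(s)²(c ≠ λ)`… precisely `D_s|_{κ_n} = 0`), and an HS-isolated hypersurface double point is isolated in
`Sing` (closed singular points nearby have embedding dimension four, hence `H = ν`; `X_n` is Jacobson) — the converse fails
(`g = z³ + w⁴`: `Λ = {0} ≠ Λ⁰`) and is not needed; (4) `e(𝒮_n, σ_n) = ē = 2` (`in₂ = X̄²` since `ord g_n ≥ 3`);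
(5) the near points of `σ_n` on `Bl_{σ_n}𝒮_n` and of `x_n` on `X_{n+1}` are the same
closed points of `ℙ¹_{(z:w)}` (`τ` stays ONE point over `κ_n(s)` iff `√λ ∉ κ_{n+1}`: NO-JUMP) with the same chart equation `X'² + g'`
(`IsoHonestSplitPropagates₂`), Hilbert–Samuel-near iff multiplicity two iff `ord g' ≥ 2`; a closed point is a permissible centre.
Why it might fail: (3) at stages where the re-chosen coefficient field moves `λ` (it does not: `λ ∈ κ''` by construction); the
`BlowupTower` packaging of the local surface tower (tree `BlowupTowerLocalize*` does the analogous localisation for threefolds).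
[cite: CossartJannsenSaito2020, Def. 6.38, Def. 6.39, Thm. 6.40, p. 107] -/
def SurfaceSliceChain₂ (N : ℕ) : Prop :=
  ∀ (ν : ℕ → ℕ) (T : BlowupTower.{u}) (pt : ∀ n, T.X n), IsMaximalOrigin 2 N ν (T.X 0) (pt 0) → IsIsoPointTower N ν T pt →
    ∀ n₀, (∀ n, n₀ ≤ n → IsE2Stage T pt n ∧ IsHonestSplitInsepAt (T.X n) (pt n)) →
      ∃ (S : BlowupTower.{u}) (σ : ∀ i, S.X (unitStart (fun _ => 1) i)),
        KeySetting S 2 ∧ CharHypothesis (S.X 0) (σ 0) ∧ IsChainOfFundamentalUnits S 2 (fun _ => 1) σ ∧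
          ∀ i, @IsIsolatedInHSMaxLocus (S.X (unitStart (fun _ => 1) i)) (S.ln _) 2 (σ i)

/-- [OURS · PROVED · SPLIT E2 TAILS ARE CLOSED BY CJS KEY THEOREM 6.40 IN DIMENSION TWO, AS PRINTED] the `√λ`-slice row and the named fact
`KeyTheorem640_char_isolated` (CJS Thm. 6.40 at initial points isolated in the Hilbert–Samuel locus, WITH the printed characteristic
hypothesis (F1) — satisfied in dimension two and characteristic two) give `IsoInsepSplitE2TailImpossible₂`.  This replaces the refuted
`AbsMilnorDrops₂` (Sketch C8 §9; tri-1 kit j277608) and frees the split cell from every 2-rank hypothesis.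
[cite: CossartJannsenSaito2020, Thm. 6.40, Thm. 13.7, Thm. 14.4] -/
theorem isoInsepSplitE2TailImpossible₂_of_slice {N : ℕ} (hS : SurfaceSliceChain₂.{u} N)
    (h640 : KeyTheorem640_char_isolated.{u}) : IsoInsepSplitE2TailImpossible₂.{u} N := by
  intro ν T pt hO hT htail
  obtain ⟨n₀, hn₀⟩ := htail
  obtain ⟨S, σ, hK, hch, hchain, hiso⟩ := hS ν T pt hO hT n₀ hn₀
  exact h640 S 2 (fun _ => 1) σ hK hch hchain hiso

/-- [OURS · PROVED · the E2 tail row after round 9] `√λ`-slice + CJS 6.40 (dim 2, printed) + layered row + propagation ⇒ the E2 tail row. -/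
theorem isoInsepE2TailImpossible₂_of_slice {N : ℕ} (hS : SurfaceSliceChain₂.{u} N) (h640 : KeyTheorem640_char_isolated.{u})
    (hL : IsoInsepLayeredE2TailImpossible₂.{u} N) (hP : IsoHonestSplitPropagates₂.{u} N) : IsoInsepE2TailImpossible₂.{u} N :=
  isoInsepE2TailImpossible₂_of_split (isoInsepSplitE2TailImpossible₂_of_slice hS h640) hL hP

/-- [OURS · PROVED · k2 AT `p = 2` MODULO NAMED ROWS, round-9 form] the residue of `T3insep` at `p = 2` is: E0, E1, k2c (PART 2′ rows),
NO-JUMP, double-point propagation, honest-split propagation, the `√λ`-slice dictionary, CJS Key Theorem 6.40 (dimension two, printed),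
and the LAYERED E2 tail row — the last being the only research-level item. -/
theorem isoInsepTowerTerminates₂_of_rows {N : ℕ} (h0 : IsoInsepE0Impossible₂.{u} N) (h1 : IsoInsepE1Impossible₂.{u} N)
    (hc : IsoInsepNonDoubleRecurrentImpossible₂.{u} N) (hJ : IsoInsepE2SuccInsep₂.{u} N) (hD : IsoDoublePointPropagates₂.{u} N)
    (hP : IsoHonestSplitPropagates₂.{u} N) (hS : SurfaceSliceChain₂.{u} N) (h640 : KeyTheorem640_char_isolated.{u})
    (hL : IsoInsepLayeredE2TailImpossible₂.{u} N) : IsoInsepTowerTerminates.{u} 2 N :=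
  isoInsepTowerTerminates₂_of_tail h0 h1 hJ hD (isoInsepE2TailImpossible₂_of_slice hS h640 hL hP) hc

end Slice

section Transfer

universe u

/-- [OURS · C10 §M.7 (T4) · algebraic] **NO DOUBLE CURVE ON THE SLICE**: over every field `K ⊇ κ` containing `s` with `s² = λ`, and in
the plane power-series ring `K⟦z,w⟧`, no non-unit `h` has `h² ∣ g + G²` for any `G` — by §M.7 (T1) this is exactly «the vertex of the
surface `𝒮 = V(X² + g) ⊂ Spec K⟦X,z,w⟧` is isolated in its multiplicity-two locus» once `G` may be taken without denominators, which
§M.7 (T3) guarantees when `g₃ ≠ 0` (`h² ∣ ∂g` forces `ord h = 1`).  `h = 0` is harmless (`0 ∣ x ↔ x = 0`, and `g = G²` is excluded by any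
non-unit `h` as well).  THE FIELD IS `K = κ(s)` EXACTLY (the clause «`K` is spanned by `1, s` over `κ`»): the proof §M.7 (T2) splits
`G = G₀ + sG₁` with `Gᵢ ∈ κ⟦z,w⟧`, and the `∀ K ⊇ κ(s)` form is locally FALSE — for `κ = 𝔽₂(λ,μ)` of 2-rank two and
`g = z³ + z²w + μw⁶` there is no double curve over `κ(s)` (`h² ∣ g_z = z²` forces `h = z`, and `z² ∣ μw⁶ + G₀² + λG₁²` needs
`μ ∈ κ² + λκ²`), but over `κ(s, √μ)` one has `g + (√μ w³)² = z²(z + w)`. -/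
def SliceNoDoubleCurve (κ : Type u) [Field κ] (lam : κ) (g : MvPowerSeries (Fin 2) κ) : Prop :=
  ∀ (K : Type u) [Field K] [Algebra κ K] (s : K), s ^ 2 = algebraMap κ K lam →
    (∀ k : K, ∃ a b : κ, k = algebraMap κ K a + algebraMap κ K b * s) →
    ∀ (h G : MvPowerSeries (Fin 2) K), ¬ IsUnit h →
      ¬ (h ^ 2 ∣ MvPowerSeries.map (algebraMap κ K) g + G ^ 2)

/-- [OURS · L1 W4.2 · C10 · **`SliceIsoTransfer₂`** (tri-1 v6.3 §R12-C10: the FIRST row of the slice line; HAND-PROVED in card §M.7 for every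
relevant stage)] along an isolated E3 point tower over a maximal origin of characteristic two, at every E2 stage `n` that is honest-split
— for EVERY honest-split presentation `𝒪̂_{X_n,x_n} ≅ κ⟦x,y,z,w⟧/(x² + λy² + g)` — the slice has no double curve: `SliceNoDoubleCurve κ λ g`.
(`g₃ ≠ 0` is automatic: the tower has an isolated near successor at every stage, card §M.2 (b).)  Proof (card §M.7, OURS, hand): a double
curve `𝔔 = (h, X + G)` upstairs with `G ∈ K⟦z,w⟧` yields, after the regular re-preparation `x′ = x + G₀`, `y′ = y + G₁`, either
`F ∈ (x′, y′, r)²` (unramified, `r² ∣ g′`) or the identity `y′²F = (y′² + m₀h₁²)·(x′² + λy′²) + m₀·(x′h₁ + y′h₀)²` (ramified,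
`r = h₀² + λh₁²`, `g′ = r m₀`) and a height-three prime `𝔭 ⊇ I_Σ + (y′² + m₀h₁²)`, `y′ ∉ 𝔭`, with `F ∈ 𝔭⁽²⁾` — a curve of `X_n(ν)` through
`x_n` (completion: CJS20 Lemma 2.37 (2)); and `g₃ ≠ 0 ⇒ ord h = 1 ⇒` no denominators are ever needed.
Why it might fail: the multiplicity step of §M.7 (T1) (`e(𝒪_{𝒮,𝔔}) = 2 ≤ ℓ(𝒪/h𝒪)` forcing the fibre `X² + ḡ` to be a square) or the
existence step of (T2)(r), if mis-argued; a discordant specimen would be an honest E2 stage with a double curve upstairs and `x_n` isolated.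
[cite: CossartJannsenSaito2020, Lemma 2.37 (2), p. 37] -/
def SliceIsoTransfer₂ (N : ℕ) : Prop :=
  ∀ (ν : ℕ → ℕ) (T : BlowupTower.{u}) (pt : ∀ n, T.X n), IsMaximalOrigin 2 N ν (T.X 0) (pt 0) → IsIsoPointTower N ν T pt →
    ∀ n, IsE2Stage T pt n →
      ∀ (κ : Type u) [Field κ] (lam : κ) (g : MvPowerSeries (Fin 2) κ), CharP κ 2 → (∀ a : κ, a ^ 2 ≠ lam) → (2 : ℕ∞) < g.order →
        Nonempty (AdicCompletion (maximalIdeal ((T.X n).presheaf.stalk (pt n))) ((T.X n).presheaf.stalk (pt n)) ≃+*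
          (MvPowerSeries (Fin 4) κ ⧸ Ideal.span {splitEq 2 lam g})) →
        SliceNoDoubleCurve κ lam g

/-- [OURS · PROVED · sanity] the algebraic form is insensitive to the trivial case: if `g` itself is a square over some `K ∋ s` then
`SliceNoDoubleCurve` fails (take `h = z`, a non-unit), so the row indeed excludes the non-reduced slice. -/
theorem not_sliceNoDoubleCurve_of_sq {κ : Type u} [Field κ] {lam : κ} {g : MvPowerSeries (Fin 2) κ}
    (K : Type u) [Field K] [CharP K 2] [Algebra κ K] (s : K) (hs : s ^ 2 = algebraMap κ K lam)
    (hspan : ∀ k : K, ∃ a b : κ, k = algebraMap κ K a + algebraMap κ K b * s)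
    (G : MvPowerSeries (Fin 2) K) (hG : MvPowerSeries.map (algebraMap κ K) g = G ^ 2) :
    ¬ SliceNoDoubleCurve κ lam g := by
  intro h
  have hz : ¬ IsUnit (MvPowerSeries.X (0 : Fin 2) : MvPowerSeries (Fin 2) K) := by
    intro hu
    have := MvPowerSeries.isUnit_iff_constantCoeff.1 hu
    simp at this
  refine h K s hs hspan (MvPowerSeries.X 0) G hz ?_
  refine ⟨0, ?_⟩
  rw [hG, mul_zero, ← two_smul K (G ^ 2), show (2 : K) = 0 from CharTwo.two_eq_zero, zero_smul]

/-- [OURS · C10 §M.7 (T6) · tri-2 TRIAGE v10.4 (B)/(iv) · THE IMAGE IDEAL] `𝔞 := (g_z, g_w, D̃g : D ∈ Der_λ(κ))`, `D̃` the coefficientwise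
extension (`MvPowerSeries.coeffDerivation`, Literature `NagataJacobianCriterion`): by tri-2's argument `Sing X_n → V(𝔞) ⊂ Spec κ⟦z,w⟧` and
`Sing 𝒮_n → V(𝔞·K⟦z,w⟧)` (`K = κ(s)`) are homeomorphisms, so `x_n` is isolated iff `𝔞` is `𝔪`-primary iff `σ_n` is isolated. [folklore] -/
def sliceJacobianIdeal {κ : Type u} [Field κ] (lam : κ) (g : MvPowerSeries (Fin 2) κ) : Ideal (MvPowerSeries (Fin 2) κ) :=
  Ideal.span (Set.range fun s : Fin 2 => MvPowerSeries.pderiv s g) ⊔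
    Ideal.span (Set.range fun D : {D : Derivation ℤ κ κ // D lam = 0} => MvPowerSeries.coeffDerivation D.1 g)

/-- [OURS · C10 §M.7 (T6) · the IMAGE-IDEAL form of the transfer (row of record per tri-2 (iv))] `𝔞` is `𝔪`-primary, as «the quotient is
finite over `κ`» (for an ideal of `κ⟦z,w⟧` inside `𝔪` this is `V(𝔞) = {0}`). -/
def SliceJacobianPrimary (κ : Type u) [Field κ] (lam : κ) (g : MvPowerSeries (Fin 2) κ) : Prop :=
  Module.Finite κ (MvPowerSeries (Fin 2) κ ⧸ sliceJacobianIdeal lam g)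

/-- [OURS · L1 W4.2 · C10 · **`SliceIsoTransferJ₂`** = `SliceIsoTransfer₂` in the IMAGE-IDEAL form (tri-2 TRIAGE v10.4 (B): both directions hold;
this row records the one the tower gives — DOWNSTAIRS half; at 2-rank one it IS PART 2′'s S-fin₂, `sliceJacobianPrimary_iff_finite_milnorAlg`)]
along an isolated E3 point tower over a maximal origin of characteristic two, at every E2 stage and for every honest-split presentation, the image
ideal `𝔞` is `𝔪`-primary.  Why it might fail: not expected to (S-fin₂'s argument — absolute Jacobian criterion `Matsumura1987_30_10_hypersurface`
+ isolation passes to the completion — with the extra coefficient derivations at higher 2-rank). [cite: Matsumura1987, Thm. 30.10 (pointer)] -/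
def SliceIsoTransferJ₂ (N : ℕ) : Prop :=
  ∀ (ν : ℕ → ℕ) (T : BlowupTower.{u}) (pt : ∀ n, T.X n), IsMaximalOrigin 2 N ν (T.X 0) (pt 0) → IsIsoPointTower N ν T pt →
    ∀ n, IsE2Stage T pt n →
      ∀ (κ : Type u) [Field κ] (lam : κ) (g : MvPowerSeries (Fin 2) κ), CharP κ 2 → (∀ a : κ, a ^ 2 ≠ lam) → (2 : ℕ∞) < g.order →
        Nonempty (AdicCompletion (maximalIdeal ((T.X n).presheaf.stalk (pt n))) ((T.X n).presheaf.stalk (pt n)) ≃+*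
          (MvPowerSeries (Fin 4) κ ⧸ Ideal.span {splitEq 2 lam g})) →
        SliceJacobianPrimary κ lam g

/-- [OURS · PROVED · 2-rank one] under PART 2′'s `hpb` (`κ = κ² + λκ²`) every `D ∈ Der_λ(κ)` kills `g` coefficientwise
(`coeffDerivation_eq_smul_lamPart`, res-D-pv-042 p534482), so `𝔞 = (g_z, g_w)` — the Milnor ideal of k2 PART 1. -/
theorem sliceJacobianIdeal_eq_of_hpb {κ : Type} [Field κ] [CharP κ 2] {lam : κ}
    (hpb : ∀ c : κ, ∃ a b : κ, c = a ^ 2 + lam * b ^ 2) (g : MvPowerSeries (Fin 2) κ) :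
    sliceJacobianIdeal lam g = Ideal.span (Set.range fun s : Fin 2 => MvPowerSeries.pderiv s g) := by
  refine le_antisymm (sup_le le_rfl (Ideal.span_le.2 ?_)) le_sup_left
  rintro _ ⟨D, rfl⟩
  have h0 : MvPowerSeries.coeffDerivation D.1 g = 0 := by
    rw [coeffDerivation_eq_smul_lamPart hpb D.1 g, D.2, zero_smul]
  show MvPowerSeries.coeffDerivation D.1 g ∈ _
  rw [h0]
  exact (Ideal.span _).zero_mem

/-- [OURS · PROVED · 2-rank one] hence `SliceJacobianPrimary κ λ g ↔ Module.Finite κ (MilnorAlg g)` (= `milnorInf g < ⊤`): at 2-rank one the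
image-ideal row is EXACTLY S-fin₂'s conclusion for the presentation. -/
theorem sliceJacobianPrimary_iff_finite_milnorAlg {κ : Type} [Field κ] [CharP κ 2] {lam : κ}
    (hpb : ∀ c : κ, ∃ a b : κ, c = a ^ 2 + lam * b ^ 2) (g : MvPowerSeries (Fin 2) κ) :
    SliceJacobianPrimary κ lam g ↔ Module.Finite κ (MilnorAlg g) := by
  unfold SliceJacobianPrimary MilnorAlg
  rw [sliceJacobianIdeal_eq_of_hpb hpb]

/-- [OURS · PROVED · 2-rank one, per presentation] **the image-ideal transfer at PB-split stages**: for `X` locally of finite type over a field,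
`dim X ≤ N`, `x` isolated in `X_max(N)` and a 2-rank-one split presentation (`κ = κ² + λκ²`), the image ideal `𝔞 = sliceJacobianIdeal λ g` is
`𝔪`-primary — granted Nagata's criterion `Matsumura1987_30_10_hypersurface` (S-fin₂ per presentation, `moduleFinite_milnorAlg_of_isIsolated`,
read through `sliceJacobianPrimary_iff_finite_milnorAlg`).  This is `SliceIsoTransferJ₂`'s conclusion at every PB-split stage. -/
theorem sliceJacobianPrimary_of_isIsolated (hJ : Matsumura1987_30_10_hypersurface.{0}) {k : Type} [Field k]
    {X : Scheme.{0}} (f : X ⟶ Spec (.of k)) [LocallyOfFiniteType f] [IsLocallyNoetherian X] {N : ℕ} {x : X}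
    (hN : topologicalKrullDim X ≤ (N : WithBot ℕ∞)) (hiso : IsIsolatedInHSMaxLocus X N x)
    {κ : Type} [Field κ] [CharP κ 2] {lam : κ} {g : MvPowerSeries (Fin 2) κ} (hlam : ∀ a : κ, a ^ 2 ≠ lam)
    (hpb : ∀ c : κ, ∃ a b : κ, c = a ^ 2 + lam * b ^ 2) (hord : (2 : ℕ∞) < g.order)
    (e : AdicCompletion (maximalIdeal (X.presheaf.stalk x)) (X.presheaf.stalk x) ≃+*
      (MvPowerSeries (Fin 4) κ ⧸ Ideal.span {splitEq 2 lam g})) :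
    SliceJacobianPrimary κ lam g :=
  (sliceJacobianPrimary_iff_finite_milnorAlg hpb g).2 (moduleFinite_milnorAlg_of_isIsolated hJ f hN hiso hlam hpb hord e)

end Transfer

end Summit.ResolutionOfSingularities.ResolutionOfSingularities.Cruxes.SigmaMaxModifications.IdeasL1C6

end
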